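import Literature.Topology.FourManifolds.CappellShanesonClassGroupFortytwo
import Literature.Topology.FourManifolds.CappellShanesonClassGroupFortytwoCls
import Literature.Topology.FourManifolds.CappellShanesonTotallyReal
import Literature.Topology.FourManifolds.CappellShanesonClassGroupTwelve
import Literature.Topology.FourManifolds.CappellShanesonClassGroupFifteen
import HarnessLib

/-!
# Trace `42`: the class group, the cover of `C(ℤ[Θ₄₂])`, Gompf's conjecture for the traces `42` and `-37`

Part 'Main' of the certified class-group computation for the trace `42` field behind
Kim–Yamada's Theorem B (`GompfConjectureForTrace 42` and, by Theorem A, `-37`), serving the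
named fact
`Literature.Topology.FourManifolds.kimYamada2023_nonempty_diffeomorph_sphere_four_of_trace_mem_Icc`
(`CappellShaneson.lean`; M. H. Kim, S. Yamada, Kyungpook Math. J. 63 (2023) 373–411 =
arXiv:1707.03860, Cor. C). The computation is split over several files only because of the
proposal size limit: `…ClassGroupFortytwo.lean` (discriminant, `𝓞 K = ℤ[θ]`, the primes of small norm), `…ClassGroupFortytwoRel<k>.lean` (two-ideal relations with certified generators and the non-vanishing of the generators), `…ClassGroupFortytwoCls.lean` (the class of every small prime in terms of the generator(s), the order relations), `…ClassGroupFortytwoMain.lean` (generation of the class group by Minkowski's bound, the cover of `C(ℤ[Θ])` by standard-matrix representatives, Gompf's conjecture for the two traces). (File generated from a certified computation; every relation is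
checked by the Lean kernel; no named fact is introduced, D-0026.)

## References

* [KimYamada2023] M. H. Kim, S. Yamada, Kyungpook Math. J. 63 (2023) 373–411 (arXiv:1707.03860):
  §2.3 (Prop. 2.14), §6.1 (Lemma 6.1 and the proof of Thm. B), Thm. A.
* [Marcus2018] D. A. Marcus, *Number Fields*, 2nd ed., Ch. 3, Thm. 27 (Dedekind–Kummer); Ch. 5,
  Cor. 2 of Thm. 37 (Minkowski bound) and the class-group computations after it.
-/

noncomputable section

open Set Polynomial Module NumberField Ideal
open scoped NumberField MatrixGroups nonZeroDivisors
open Literature.LinearAlgebra.Matrix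

namespace Literature.Topology.FourManifolds

section Field

variable {K : Type*} [Field K] [NumberField K] {θ : K}

set_option maxHeartbeats 2000000 in
/-- **Every ideal class of the trace `42` field is a power `aʳ`, `0 ≤ r < 10`, of `a = [(7, θ - 5)]`,
represented by the ideals listed** (so the class number divides `10`). Proof: `d_K = 2424217`,
`⌊M_K⌋ ≤ 345`, Dedekind–Kummer at `p ≤ 345`, and the class of every small prime computed above
from two-ideal relations with certified generators. [cite: KimYamada2023, §6.1 (proof of Thm. B)] -/
theorem classGroup_mem_fortytwo (hθ : aeval θ (csPoly 42) = 0) (h3 : finrank ℚ K = 3)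
    (C : ClassGroup (𝓞 K)) :
    C = 1 ∨
      C = ClassGroup.mk0 ⟨span {(7 : 𝓞 K), thetaInt hθ - 5}, (span_pair_ofNat_mem_nonZeroDivisors (nat_lit 7) (thetaInt hθ - 5))⟩ ∨
      C = ClassGroup.mk0 ⟨span {(17 : 𝓞 K), thetaInt hθ - 16}, (span_pair_ofNat_mem_nonZeroDivisors (nat_lit 17) (thetaInt hθ - 16))⟩ ∨
      C = ClassGroup.mk0 ⟨span {(43 : 𝓞 K), thetaInt hθ - 19}, (span_pair_ofNat_mem_nonZeroDivisors (nat_lit 43) (thetaInt hθ - 19))⟩ ∨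
      C = ClassGroup.mk0 ⟨span {(17 : 𝓞 K), thetaInt hθ - 13}, (span_pair_ofNat_mem_nonZeroDivisors (nat_lit 17) (thetaInt hθ - 13))⟩ ∨
      C = ClassGroup.mk0 ⟨span {(23 : 𝓞 K), thetaInt hθ - 20}, (span_pair_ofNat_mem_nonZeroDivisors (nat_lit 23) (thetaInt hθ - 20))⟩ ∨
      C = ClassGroup.mk0 ⟨span {(53 : 𝓞 K), thetaInt hθ - 49}, (span_pair_ofNat_mem_nonZeroDivisors (nat_lit 53) (thetaInt hθ - 49))⟩ ∨
      C = ClassGroup.mk0 ⟨span {(101 : 𝓞 K), thetaInt hθ - 74}, (span_pair_ofNat_mem_nonZeroDivisors (nat_lit 101) (thetaInt hθ - 74))⟩ ∨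
      C = ClassGroup.mk0 ⟨span {(5 : 𝓞 K), thetaInt hθ - 4}, (span_pair_ofNat_mem_nonZeroDivisors (nat_lit 5) (thetaInt hθ - 4))⟩ ∨
      C = ClassGroup.mk0 ⟨span {(31 : 𝓞 K), thetaInt hθ - 21}, (span_pair_ofNat_mem_nonZeroDivisors (nat_lit 31) (thetaInt hθ - 21))⟩ := by
  classical
  obtain ⟨a, ha⟩ : ∃ a : ClassGroup (𝓞 K), ClassGroup.mk0 ⟨span {(7 : 𝓞 K), thetaInt hθ - 5}, (span_pair_ofNat_mem_nonZeroDivisors (nat_lit 7) (thetaInt hθ - 5))⟩ = a := ⟨_, rfl⟩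
  have ham : a ^ (10 : ℤ) = 1 := by rw [← ha]; exact pow_order_fortytwo hθ
  let H : Subgroup (ClassGroup (𝓞 K)) := Subgroup.zpowers a
  have hprinc : ∀ (P : Ideal (𝓞 K)) (hP0 : P ∈ (Ideal (𝓞 K))⁰) (x : 𝓞 K), P = span {x} →
      ClassGroup.mk0 ⟨P, hP0⟩ ∈ H := by
    intro P hP0 x hPx
    have : ClassGroup.mk0 ⟨P, hP0⟩ = 1 :=
      (ClassGroup.mk0_eq_one_iff hP0).mpr ⟨⟨x, by rw [hPx, submodule_span_eq]⟩⟩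
    rw [this]
    exact H.one_mem
  -- Minkowski: `⌊M_K⌋ ≤ 345`
  have hd : ((|NumberField.discr K| : ℤ) : ℝ) ≤ (2424217 : ℕ) := by
    rw [discr_eq_fortytwo hθ h3]
    norm_num
  have hfloor := floor_minkowskiBound_le_cubic_real h3 (nrComplexPlaces_eq_zero_of_csPoly hθ h3 (by norm_num))
    hd (s := 1556.99) (U := 345) (by norm_num) (by norm_num) (by norm_num)
  have htop : H = ⊤ := by
    refine classGroup_subgroup_eq_top_of_primesOver H hfloor fun p hp hprime P hP0 hP hle => ?_
    have hpU : p ≤ 345 := (Finset.mem_Icc.mp hp).2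
    have h1p : 1 ≤ p := (Finset.mem_Icc.mp hp).1
    interval_cases p
    · exact absurd hprime (by norm_num)
    · exact hprinc P hP0 _ (eq_span_of_inert_fortytwo hθ h3 (by norm_num) hP)
    · exact hprinc P hP0 _ (eq_span_of_inert_fortytwo hθ h3 (by norm_num) hP)
    · exact absurd hprime (by norm_num)
    · -- `p = 5`
      rcases eq_P5_or_eq_Q5_fortytwo hθ h3 hP with h | h <;> subst h
      · exact mem_zpowers_of_mk0_eq a (cls_P5_4_fortytwo hθ) ha
      · exact mem_zpowers_of_mk0_eq a (cls_Q5_fortytwo hθ) ha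
    · exact absurd hprime (by norm_num)
    · -- `p = 7`
      rcases eq_P7_or_eq_Q7_fortytwo hθ h3 hP with h | h <;> subst h
      · rw [show ClassGroup.mk0 ⟨_, hP0⟩ = ClassGroup.mk0 ⟨span {(7 : 𝓞 K), thetaInt hθ - 5}, (span_pair_ofNat_mem_nonZeroDivisors (nat_lit 7) (thetaInt hθ - 5))⟩ from rfl, ha]
        exact Subgroup.mem_zpowers a
      · exact mem_zpowers_of_mk0_eq a (cls_Q7_fortytwo hθ) ha
    · exact absurd hprime (by norm_num)
    · exact absurd hprime (by norm_num)
    · exact absurd hprime (by norm_num)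
    · exact hprinc P hP0 _ (eq_span_of_inert_fortytwo hθ h3 (by norm_num) hP)
    · exact absurd hprime (by norm_num)
    · exact hprinc P hP0 _ (eq_span_of_inert_fortytwo hθ h3 (by norm_num) hP)
    · exact absurd hprime (by norm_num)
    · exact absurd hprime (by norm_num)
    · exact absurd hprime (by norm_num)
    · -- `p = 17` (ramified)
      rcases eq_P17_fortytwo hθ h3 hP with h | h | h <;> subst h
      · exact mem_zpowers_of_mk0_eq a (cls_P17_13_fortytwo hθ) ha
      · exact mem_zpowers_of_mk0_eq a (cls_P17_13_fortytwo hθ) ha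
      · exact mem_zpowers_of_mk0_eq a (cls_P17_16_fortytwo hθ) ha
    · exact absurd hprime (by norm_num)
    · exact hprinc P hP0 _ (eq_span_of_inert_fortytwo hθ h3 (by norm_num) hP)
    · exact absurd hprime (by norm_num)
    · exact absurd hprime (by norm_num)
    · exact absurd hprime (by norm_num)
    · -- `p = 23`
      have h := eq_span_pair_of_unique_root_fortytwo hθ h3 (Or.inl ⟨rfl, rfl⟩) hP hle
      simp only [Nat.cast_ofNat, Int.cast_ofNat] at h
      subst h
      exact mem_zpowers_of_mk0_eq a (cls_P23_20_fortytwo hθ) ha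
    · exact absurd hprime (by norm_num)
    · exact absurd hprime (by norm_num)
    · exact absurd hprime (by norm_num)
    · exact absurd hprime (by norm_num)
    · exact absurd hprime (by norm_num)
    · exact hprinc P hP0 _ (eq_span_of_inert_fortytwo hθ h3 (by norm_num) hP)
    · exact absurd hprime (by norm_num)
    · -- `p = 31`
      have h := eq_span_pair_of_unique_root_fortytwo hθ h3 (Or.inr (Or.inl ⟨rfl, rfl⟩)) hP hle
      simp only [Nat.cast_ofNat, Int.cast_ofNat] at h
      subst h
      exact mem_zpowers_of_mk0_eq a (cls_P31_21_fortytwo hθ) ha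
    · exact absurd hprime (by norm_num)
    · exact absurd hprime (by norm_num)
    · exact absurd hprime (by norm_num)
    · exact absurd hprime (by norm_num)
    · exact absurd hprime (by norm_num)
    · -- `p = 37`
      have h := eq_span_pair_of_unique_root_fortytwo hθ h3 (Or.inr (Or.inr (Or.inl ⟨rfl, rfl⟩))) hP hle
      simp only [Nat.cast_ofNat, Int.cast_ofNat] at h
      subst h
      exact mem_zpowers_of_mk0_eq a (cls_P37_35_fortytwo hθ) ha
    · exact absurd hprime (by norm_num)
    · exact absurd hprime (by norm_num)
    · exact absurd hprime (by norm_num)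
    · exact hprinc P hP0 _ (eq_span_of_inert_fortytwo hθ h3 (by norm_num) hP)
    · exact absurd hprime (by norm_num)
    · -- `p = 43` (splits)
      rcases eq_P43_fortytwo hθ h3 hP with h | h | h <;> subst h
      · exact mem_zpowers_of_mk0_eq a (cls_P43_8_fortytwo hθ) ha
      · exact mem_zpowers_of_mk0_eq a (cls_P43_15_fortytwo hθ) ha
      · exact mem_zpowers_of_mk0_eq a (cls_P43_19_fortytwo hθ) ha
    · exact absurd hprime (by norm_num)
    · exact absurd hprime (by norm_num)
    · exact absurd hprime (by norm_num)
    · exact hprinc P hP0 _ (eq_span_of_inert_fortytwo hθ h3 (by norm_num) hP)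
    · exact absurd hprime (by norm_num)
    · exact absurd hprime (by norm_num)
    · exact absurd hprime (by norm_num)
    · exact absurd hprime (by norm_num)
    · exact absurd hprime (by norm_num)
    · -- `p = 53`
      have h := eq_span_pair_of_unique_root_fortytwo hθ h3 (Or.inr (Or.inr (Or.inr (Or.inl ⟨rfl, rfl⟩)))) hP hle
      simp only [Nat.cast_ofNat, Int.cast_ofNat] at h
      subst h
      exact mem_zpowers_of_mk0_eq a (cls_P53_49_fortytwo hθ) ha
    · exact absurd hprime (by norm_num)
    · exact absurd hprime (by norm_num)
    · exact absurd hprime (by norm_num)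
    · exact absurd hprime (by norm_num)
    · exact absurd hprime (by norm_num)
    · exact hprinc P hP0 _ (eq_span_of_inert_fortytwo hθ h3 (by norm_num) hP)
    · exact absurd hprime (by norm_num)
    · exact hprinc P hP0 _ (eq_span_of_inert_fortytwo hθ h3 (by norm_num) hP)
    · exact absurd hprime (by norm_num)
    · exact absurd hprime (by norm_num)
    · exact absurd hprime (by norm_num)
    · exact absurd hprime (by norm_num)
    · exact absurd hprime (by norm_num)
    · exact hprinc P hP0 _ (eq_span_of_inert_fortytwo hθ h3 (by norm_num) hP)
    · exact absurd hprime (by norm_num)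
    · exact absurd hprime (by norm_num)
    · exact absurd hprime (by norm_num)
    · -- `p = 71` (splits)
      rcases eq_P71_fortytwo hθ h3 hP with h | h | h <;> subst h
      · exact mem_zpowers_of_mk0_eq a (cls_P71_31_fortytwo hθ) ha
      · exact mem_zpowers_of_mk0_eq a (cls_P71_33_fortytwo hθ) ha
      · exact mem_zpowers_of_mk0_eq a (cls_P71_49_fortytwo hθ) ha
    · exact absurd hprime (by norm_num)
    · -- `p = 73`
      have h := eq_span_pair_of_unique_root_fortytwo hθ h3 (Or.inr (Or.inr (Or.inr (Or.inr (Or.inl ⟨rfl, rfl⟩))))) hP hle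
      simp only [Nat.cast_ofNat, Int.cast_ofNat] at h
      subst h
      exact hprinc _ hP0 _ (P73_37_eq_fortytwo hθ)
    · exact absurd hprime (by norm_num)
    · exact absurd hprime (by norm_num)
    · exact absurd hprime (by norm_num)
    · exact absurd hprime (by norm_num)
    · exact absurd hprime (by norm_num)
    · -- `p = 79` (splits)
      rcases eq_P79_fortytwo hθ h3 hP with h | h | h <;> subst h
      · exact hprinc _ hP0 _ (P79_2_eq_fortytwo hθ)
      · exact mem_zpowers_of_mk0_eq a (cls_P79_46_fortytwo hθ) ha
      · exact mem_zpowers_of_mk0_eq a (cls_P79_73_fortytwo hθ) ha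
    · exact absurd hprime (by norm_num)
    · exact absurd hprime (by norm_num)
    · exact absurd hprime (by norm_num)
    · exact hprinc P hP0 _ (eq_span_of_inert_fortytwo hθ h3 (by norm_num) hP)
    · exact absurd hprime (by norm_num)
    · exact absurd hprime (by norm_num)
    · exact absurd hprime (by norm_num)
    · exact absurd hprime (by norm_num)
    · exact absurd hprime (by norm_num)
    · -- `p = 89`
      have h := eq_span_pair_of_unique_root_fortytwo hθ h3 (Or.inr (Or.inr (Or.inr (Or.inr (Or.inr (Or.inl ⟨rfl, rfl⟩)))))) hP hle
      simp only [Nat.cast_ofNat, Int.cast_ofNat] at h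
      subst h
      exact mem_zpowers_of_mk0_eq a (cls_P89_4_fortytwo hθ) ha
    · exact absurd hprime (by norm_num)
    · exact absurd hprime (by norm_num)
    · exact absurd hprime (by norm_num)
    · exact absurd hprime (by norm_num)
    · exact absurd hprime (by norm_num)
    · exact absurd hprime (by norm_num)
    · exact absurd hprime (by norm_num)
    · -- `p = 97`
      have h := eq_span_pair_of_unique_root_fortytwo hθ h3 (Or.inr (Or.inr (Or.inr (Or.inr (Or.inr (Or.inr (Or.inl ⟨rfl, rfl⟩))))))) hP hle
      simp only [Nat.cast_ofNat, Int.cast_ofNat] at h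
      subst h
      exact mem_zpowers_of_mk0_eq a (cls_P97_59_fortytwo hθ) ha
    · exact absurd hprime (by norm_num)
    · exact absurd hprime (by norm_num)
    · exact absurd hprime (by norm_num)
    · -- `p = 101`
      have h := eq_span_pair_of_unique_root_fortytwo hθ h3 (Or.inr (Or.inr (Or.inr (Or.inr (Or.inr (Or.inr (Or.inr (Or.inl ⟨rfl, rfl⟩)))))))) hP hle
      simp only [Nat.cast_ofNat, Int.cast_ofNat] at h
      subst h
      exact mem_zpowers_of_mk0_eq a (cls_P101_74_fortytwo hθ) ha
    · exact absurd hprime (by norm_num)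
    · -- `p = 103` (splits)
      rcases eq_P103_fortytwo hθ h3 hP with h | h | h <;> subst h
      · exact mem_zpowers_of_mk0_eq a (cls_P103_5_fortytwo hθ) ha
      · exact mem_zpowers_of_mk0_eq a (cls_P103_60_fortytwo hθ) ha
      · exact mem_zpowers_of_mk0_eq a (cls_P103_80_fortytwo hθ) ha
    · exact absurd hprime (by norm_num)
    · exact absurd hprime (by norm_num)
    · exact absurd hprime (by norm_num)
    · exact hprinc P hP0 _ (eq_span_of_inert_fortytwo hθ h3 (by norm_num) hP)
    · exact absurd hprime (by norm_num)
    · -- `p = 109`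
      have h := eq_span_pair_of_unique_root_fortytwo hθ h3 (Or.inr (Or.inr (Or.inr (Or.inr (Or.inr (Or.inr (Or.inr (Or.inr (Or.inl ⟨rfl, rfl⟩))))))))) hP hle
      simp only [Nat.cast_ofNat, Int.cast_ofNat] at h
      subst h
      exact mem_zpowers_of_mk0_eq a (cls_P109_47_fortytwo hθ) ha
    · exact absurd hprime (by norm_num)
    · exact absurd hprime (by norm_num)
    · exact absurd hprime (by norm_num)
    · exact hprinc P hP0 _ (eq_span_of_inert_fortytwo hθ h3 (by norm_num) hP)
    · exact absurd hprime (by norm_num)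
    · exact absurd hprime (by norm_num)
    · exact absurd hprime (by norm_num)
    · exact absurd hprime (by norm_num)
    · exact absurd hprime (by norm_num)
    · exact absurd hprime (by norm_num)
    · exact absurd hprime (by norm_num)
    · exact absurd hprime (by norm_num)
    · exact absurd hprime (by norm_num)
    · exact absurd hprime (by norm_num)
    · exact absurd hprime (by norm_num)
    · exact absurd hprime (by norm_num)
    · exact absurd hprime (by norm_num)
    · -- `p = 127` (splits)
      rcases eq_P127_fortytwo hθ h3 hP with h | h | h <;> subst h
      · exact mem_zpowers_of_mk0_eq a (cls_P127_15_fortytwo hθ) ha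
      · exact mem_zpowers_of_mk0_eq a (cls_P127_59_fortytwo hθ) ha
      · exact mem_zpowers_of_mk0_eq a (cls_P127_95_fortytwo hθ) ha
    · exact absurd hprime (by norm_num)
    · exact absurd hprime (by norm_num)
    · exact absurd hprime (by norm_num)
    · -- `p = 131` (splits)
      rcases eq_P131_fortytwo hθ h3 hP with h | h | h <;> subst h
      · exact mem_zpowers_of_mk0_eq a (cls_P131_31_fortytwo hθ) ha
      · exact mem_zpowers_of_mk0_eq a (cls_P131_46_fortytwo hθ) ha
      · exact mem_zpowers_of_mk0_eq a (cls_P131_96_fortytwo hθ) ha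
    · exact absurd hprime (by norm_num)
    · exact absurd hprime (by norm_num)
    · exact absurd hprime (by norm_num)
    · exact absurd hprime (by norm_num)
    · exact absurd hprime (by norm_num)
    · exact hprinc P hP0 _ (eq_span_of_inert_fortytwo hθ h3 (by norm_num) hP)
    · exact absurd hprime (by norm_num)
    · exact hprinc P hP0 _ (eq_span_of_inert_fortytwo hθ h3 (by norm_num) hP)
    · exact absurd hprime (by norm_num)
    · exact absurd hprime (by norm_num)
    · exact absurd hprime (by norm_num)
    · exact absurd hprime (by norm_num)
    · exact absurd hprime (by norm_num)
    · exact absurd hprime (by norm_num)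
    · exact absurd hprime (by norm_num)
    · exact absurd hprime (by norm_num)
    · exact absurd hprime (by norm_num)
    · -- `p = 149`
      have h := eq_span_pair_of_unique_root_fortytwo hθ h3 (Or.inr (Or.inr (Or.inr (Or.inr (Or.inr (Or.inr (Or.inr (Or.inr (Or.inr (Or.inl ⟨rfl, rfl⟩)))))))))) hP hle
      simp only [Nat.cast_ofNat, Int.cast_ofNat] at h
      subst h
      exact mem_zpowers_of_mk0_eq a (cls_P149_115_fortytwo hθ) ha
    · exact absurd hprime (by norm_num)
    · -- `p = 151`
      have h := eq_span_pair_of_unique_root_fortytwo hθ h3 (Or.inr (Or.inr (Or.inr (Or.inr (Or.inr (Or.inr (Or.inr (Or.inr (Or.inr (Or.inr (Or.inl ⟨rfl, rfl⟩))))))))))) hP hle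
      simp only [Nat.cast_ofNat, Int.cast_ofNat] at h
      subst h
      exact mem_zpowers_of_mk0_eq a (cls_P151_132_fortytwo hθ) ha
    · exact absurd hprime (by norm_num)
    · exact absurd hprime (by norm_num)
    · exact absurd hprime (by norm_num)
    · exact absurd hprime (by norm_num)
    · exact absurd hprime (by norm_num)
    · -- `p = 157`
      have h := eq_span_pair_of_unique_root_fortytwo hθ h3 (Or.inr (Or.inr (Or.inr (Or.inr (Or.inr (Or.inr (Or.inr (Or.inr (Or.inr (Or.inr (Or.inr (Or.inl ⟨rfl, rfl⟩)))))))))))) hP hle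
      simp only [Nat.cast_ofNat, Int.cast_ofNat] at h
      subst h
      exact mem_zpowers_of_mk0_eq a (cls_P157_43_fortytwo hθ) ha
    · exact absurd hprime (by norm_num)
    · exact absurd hprime (by norm_num)
    · exact absurd hprime (by norm_num)
    · exact absurd hprime (by norm_num)
    · exact absurd hprime (by norm_num)
    · exact hprinc P hP0 _ (eq_span_of_inert_fortytwo hθ h3 (by norm_num) hP)
    · exact absurd hprime (by norm_num)
    · exact absurd hprime (by norm_num)
    · exact absurd hprime (by norm_num)
    · -- `p = 167`
      have h := eq_span_pair_of_unique_root_fortytwo hθ h3 (Or.inr (Or.inr (Or.inr (Or.inr (Or.inr (Or.inr (Or.inr (Or.inr (Or.inr (Or.inr (Or.inr (Or.inr (Or.inl ⟨rfl, rfl⟩))))))))))))) hP hle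
      simp only [Nat.cast_ofNat, Int.cast_ofNat] at h
      subst h
      exact mem_zpowers_of_mk0_eq a (cls_P167_102_fortytwo hθ) ha
    · exact absurd hprime (by norm_num)
    · exact absurd hprime (by norm_num)
    · exact absurd hprime (by norm_num)
    · exact absurd hprime (by norm_num)
    · exact absurd hprime (by norm_num)
    · -- `p = 173`
      have h := eq_span_pair_of_unique_root_fortytwo hθ h3 (Or.inr (Or.inr (Or.inr (Or.inr (Or.inr (Or.inr (Or.inr (Or.inr (Or.inr (Or.inr (Or.inr (Or.inr (Or.inr (Or.inl ⟨rfl, rfl⟩)))))))))))))) hP hle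
      simp only [Nat.cast_ofNat, Int.cast_ofNat] at h
      subst h
      exact mem_zpowers_of_mk0_eq a (cls_P173_107_fortytwo hθ) ha
    · exact absurd hprime (by norm_num)
    · exact absurd hprime (by norm_num)
    · exact absurd hprime (by norm_num)
    · exact absurd hprime (by norm_num)
    · exact absurd hprime (by norm_num)
    · exact hprinc P hP0 _ (eq_span_of_inert_fortytwo hθ h3 (by norm_num) hP)
    · exact absurd hprime (by norm_num)
    · -- `p = 181`
      have h := eq_span_pair_of_unique_root_fortytwo hθ h3 (Or.inr (Or.inr (Or.inr (Or.inr (Or.inr (Or.inr (Or.inr (Or.inr (Or.inr (Or.inr (Or.inr (Or.inr (Or.inr (Or.inr (Or.inl ⟨rfl, rfl⟩))))))))))))))) hP hle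
      simp only [Nat.cast_ofNat, Int.cast_ofNat] at h
      subst h
      exact mem_zpowers_of_mk0_eq a (cls_P181_171_fortytwo hθ) ha
    · exact absurd hprime (by norm_num)
    · exact absurd hprime (by norm_num)
    · exact absurd hprime (by norm_num)
    · exact absurd hprime (by norm_num)
    · exact absurd hprime (by norm_num)
    · exact absurd hprime (by norm_num)
    · exact absurd hprime (by norm_num)
    · exact absurd hprime (by norm_num)
    · exact absurd hprime (by norm_num)
    · exact hprinc P hP0 _ (eq_span_of_inert_fortytwo hθ h3 (by norm_num) hP)
    · exact absurd hprime (by norm_num)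
    · -- `p = 193` (splits)
      rcases eq_P193_fortytwo hθ h3 hP with h | h | h <;> subst h
      · exact mem_zpowers_of_mk0_eq a (cls_P193_35_fortytwo hθ) ha
      · exact mem_zpowers_of_mk0_eq a (cls_P193_81_fortytwo hθ) ha
      · exact mem_zpowers_of_mk0_eq a (cls_P193_119_fortytwo hθ) ha
    · exact absurd hprime (by norm_num)
    · exact absurd hprime (by norm_num)
    · exact absurd hprime (by norm_num)
    · exact hprinc P hP0 _ (eq_span_of_inert_fortytwo hθ h3 (by norm_num) hP)
    · exact absurd hprime (by norm_num)
    · -- `p = 199`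
      have h := eq_span_pair_of_unique_root_fortytwo hθ h3 (Or.inr (Or.inr (Or.inr (Or.inr (Or.inr (Or.inr (Or.inr (Or.inr (Or.inr (Or.inr (Or.inr (Or.inr (Or.inr (Or.inr (Or.inr (Or.inl ⟨rfl, rfl⟩)))))))))))))))) hP hle
      simp only [Nat.cast_ofNat, Int.cast_ofNat] at h
      subst h
      exact mem_zpowers_of_mk0_eq a (cls_P199_26_fortytwo hθ) ha
    · exact absurd hprime (by norm_num)
    · exact absurd hprime (by norm_num)
    · exact absurd hprime (by norm_num)
    · exact absurd hprime (by norm_num)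
    · exact absurd hprime (by norm_num)
    · exact absurd hprime (by norm_num)
    · exact absurd hprime (by norm_num)
    · exact absurd hprime (by norm_num)
    · exact absurd hprime (by norm_num)
    · exact absurd hprime (by norm_num)
    · exact absurd hprime (by norm_num)
    · -- `p = 211`
      have h := eq_span_pair_of_unique_root_fortytwo hθ h3 (Or.inr (Or.inr (Or.inr (Or.inr (Or.inr (Or.inr (Or.inr (Or.inr (Or.inr (Or.inr (Or.inr (Or.inr (Or.inr (Or.inr (Or.inr (Or.inr (Or.inl ⟨rfl, rfl⟩))))))))))))))))) hP hle
      simp only [Nat.cast_ofNat, Int.cast_ofNat] at h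
      subst h
      exact mem_zpowers_of_mk0_eq a (cls_P211_86_fortytwo hθ) ha
    · exact absurd hprime (by norm_num)
    · exact absurd hprime (by norm_num)
    · exact absurd hprime (by norm_num)
    · exact absurd hprime (by norm_num)
    · exact absurd hprime (by norm_num)
    · exact absurd hprime (by norm_num)
    · exact absurd hprime (by norm_num)
    · exact absurd hprime (by norm_num)
    · exact absurd hprime (by norm_num)
    · exact absurd hprime (by norm_num)
    · exact absurd hprime (by norm_num)
    · -- `p = 223`
      have h := eq_span_pair_of_unique_root_fortytwo hθ h3 (Or.inr (Or.inr (Or.inr (Or.inr (Or.inr (Or.inr (Or.inr (Or.inr (Or.inr (Or.inr (Or.inr (Or.inr (Or.inr (Or.inr (Or.inr (Or.inr (Or.inr (Or.inl ⟨rfl, rfl⟩)))))))))))))))))) hP hle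
      simp only [Nat.cast_ofNat, Int.cast_ofNat] at h
      subst h
      exact mem_zpowers_of_mk0_eq a (cls_P223_40_fortytwo hθ) ha
    · exact absurd hprime (by norm_num)
    · exact absurd hprime (by norm_num)
    · exact absurd hprime (by norm_num)
    · -- `p = 227` (splits)
      rcases eq_P227_fortytwo hθ h3 hP with h | h | h <;> subst h
      · exact mem_zpowers_of_mk0_eq a (cls_P227_44_fortytwo hθ) ha
      · exact mem_zpowers_of_mk0_eq a (cls_P227_106_fortytwo hθ) ha
      · exact mem_zpowers_of_mk0_eq a (cls_P227_119_fortytwo hθ) ha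
    · exact absurd hprime (by norm_num)
    · -- `p = 229`
      have h := eq_span_pair_of_unique_root_fortytwo hθ h3 (Or.inr (Or.inr (Or.inr (Or.inr (Or.inr (Or.inr (Or.inr (Or.inr (Or.inr (Or.inr (Or.inr (Or.inr (Or.inr (Or.inr (Or.inr (Or.inr (Or.inr (Or.inr (Or.inl ⟨rfl, rfl⟩))))))))))))))))))) hP hle
      simp only [Nat.cast_ofNat, Int.cast_ofNat] at h
      subst h
      exact hprinc _ hP0 _ (P229_3_eq_fortytwo hθ)
    · exact absurd hprime (by norm_num)
    · exact absurd hprime (by norm_num)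
    · exact absurd hprime (by norm_num)
    · exact hprinc P hP0 _ (eq_span_of_inert_fortytwo hθ h3 (by norm_num) hP)
    · exact absurd hprime (by norm_num)
    · exact absurd hprime (by norm_num)
    · exact absurd hprime (by norm_num)
    · exact absurd hprime (by norm_num)
    · exact absurd hprime (by norm_num)
    · exact hprinc P hP0 _ (eq_span_of_inert_fortytwo hθ h3 (by norm_num) hP)
    · exact absurd hprime (by norm_num)
    · exact hprinc P hP0 _ (eq_span_of_inert_fortytwo hθ h3 (by norm_num) hP)
    · exact absurd hprime (by norm_num)
    · exact absurd hprime (by norm_num)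
    · exact absurd hprime (by norm_num)
    · exact absurd hprime (by norm_num)
    · exact absurd hprime (by norm_num)
    · exact absurd hprime (by norm_num)
    · exact absurd hprime (by norm_num)
    · exact absurd hprime (by norm_num)
    · exact absurd hprime (by norm_num)
    · -- `p = 251`
      have h := eq_span_pair_of_unique_root_fortytwo hθ h3 (Or.inr (Or.inr (Or.inr (Or.inr (Or.inr (Or.inr (Or.inr (Or.inr (Or.inr (Or.inr (Or.inr (Or.inr (Or.inr (Or.inr (Or.inr (Or.inr (Or.inr (Or.inr (Or.inr (Or.inl ⟨rfl, rfl⟩)))))))))))))))))))) hP hle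
      simp only [Nat.cast_ofNat, Int.cast_ofNat] at h
      subst h
      exact mem_zpowers_of_mk0_eq a (cls_P251_136_fortytwo hθ) ha
    · exact absurd hprime (by norm_num)
    · exact absurd hprime (by norm_num)
    · exact absurd hprime (by norm_num)
    · exact absurd hprime (by norm_num)
    · exact absurd hprime (by norm_num)
    · -- `p = 257` (splits)
      rcases eq_P257_fortytwo hθ h3 hP with h | h | h <;> subst h
      · exact mem_zpowers_of_mk0_eq a (cls_P257_13_fortytwo hθ) ha
      · exact hprinc _ hP0 _ (P257_128_eq_fortytwo hθ)
      · exact mem_zpowers_of_mk0_eq a (cls_P257_158_fortytwo hθ) ha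
    · exact absurd hprime (by norm_num)
    · exact absurd hprime (by norm_num)
    · exact absurd hprime (by norm_num)
    · exact absurd hprime (by norm_num)
    · exact absurd hprime (by norm_num)
    · -- `p = 263`
      have h := eq_span_pair_of_unique_root_fortytwo hθ h3 (Or.inr (Or.inr (Or.inr (Or.inr (Or.inr (Or.inr (Or.inr (Or.inr (Or.inr (Or.inr (Or.inr (Or.inr (Or.inr (Or.inr (Or.inr (Or.inr (Or.inr (Or.inr (Or.inr (Or.inr (Or.inl ⟨rfl, rfl⟩))))))))))))))))))))) hP hle
      simp only [Nat.cast_ofNat, Int.cast_ofNat] at h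
      subst h
      exact mem_zpowers_of_mk0_eq a (cls_P263_156_fortytwo hθ) ha
    · exact absurd hprime (by norm_num)
    · exact absurd hprime (by norm_num)
    · exact absurd hprime (by norm_num)
    · exact absurd hprime (by norm_num)
    · exact absurd hprime (by norm_num)
    · exact hprinc P hP0 _ (eq_span_of_inert_fortytwo hθ h3 (by norm_num) hP)
    · exact absurd hprime (by norm_num)
    · -- `p = 271` (splits)
      rcases eq_P271_fortytwo hθ h3 hP with h | h | h <;> subst h
      · exact mem_zpowers_of_mk0_eq a (cls_P271_21_fortytwo hθ) ha
      · exact mem_zpowers_of_mk0_eq a (cls_P271_140_fortytwo hθ) ha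
      · exact mem_zpowers_of_mk0_eq a (cls_P271_152_fortytwo hθ) ha
    · exact absurd hprime (by norm_num)
    · exact absurd hprime (by norm_num)
    · exact absurd hprime (by norm_num)
    · exact absurd hprime (by norm_num)
    · exact absurd hprime (by norm_num)
    · exact hprinc P hP0 _ (eq_span_of_inert_fortytwo hθ h3 (by norm_num) hP)
    · exact absurd hprime (by norm_num)
    · exact absurd hprime (by norm_num)
    · exact absurd hprime (by norm_num)
    · -- `p = 281`
      have h := eq_span_pair_of_unique_root_fortytwo hθ h3 (Or.inr (Or.inr (Or.inr (Or.inr (Or.inr (Or.inr (Or.inr (Or.inr (Or.inr (Or.inr (Or.inr (Or.inr (Or.inr (Or.inr (Or.inr (Or.inr (Or.inr (Or.inr (Or.inr (Or.inr (Or.inr (Or.inl ⟨rfl, rfl⟩)))))))))))))))))))))) hP hle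
      simp only [Nat.cast_ofNat, Int.cast_ofNat] at h
      subst h
      exact mem_zpowers_of_mk0_eq a (cls_P281_245_fortytwo hθ) ha
    · exact absurd hprime (by norm_num)
    · -- `p = 283`
      have h := eq_span_pair_of_unique_root_fortytwo hθ h3 (Or.inr (Or.inr (Or.inr (Or.inr (Or.inr (Or.inr (Or.inr (Or.inr (Or.inr (Or.inr (Or.inr (Or.inr (Or.inr (Or.inr (Or.inr (Or.inr (Or.inr (Or.inr (Or.inr (Or.inr (Or.inr (Or.inr (Or.inl ⟨rfl, rfl⟩))))))))))))))))))))))) hP hle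
      simp only [Nat.cast_ofNat, Int.cast_ofNat] at h
      subst h
      exact mem_zpowers_of_mk0_eq a (cls_P283_229_fortytwo hθ) ha
    · exact absurd hprime (by norm_num)
    · exact absurd hprime (by norm_num)
    · exact absurd hprime (by norm_num)
    · exact absurd hprime (by norm_num)
    · exact absurd hprime (by norm_num)
    · exact absurd hprime (by norm_num)
    · exact absurd hprime (by norm_num)
    · exact absurd hprime (by norm_num)
    · exact absurd hprime (by norm_num)
    · exact hprinc P hP0 _ (eq_span_of_inert_fortytwo hθ h3 (by norm_num) hP)
    · exact absurd hprime (by norm_num)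
    · exact absurd hprime (by norm_num)
    · exact absurd hprime (by norm_num)
    · exact absurd hprime (by norm_num)
    · exact absurd hprime (by norm_num)
    · exact absurd hprime (by norm_num)
    · exact absurd hprime (by norm_num)
    · exact absurd hprime (by norm_num)
    · exact absurd hprime (by norm_num)
    · exact absurd hprime (by norm_num)
    · exact absurd hprime (by norm_num)
    · exact absurd hprime (by norm_num)
    · exact absurd hprime (by norm_num)
    · exact hprinc P hP0 _ (eq_span_of_inert_fortytwo hθ h3 (by norm_num) hP)
    · exact absurd hprime (by norm_num)
    · exact absurd hprime (by norm_num)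
    · exact absurd hprime (by norm_num)
    · -- `p = 311`
      have h := eq_span_pair_of_unique_root_fortytwo hθ h3 (Or.inr (Or.inr (Or.inr (Or.inr (Or.inr (Or.inr (Or.inr (Or.inr (Or.inr (Or.inr (Or.inr (Or.inr (Or.inr (Or.inr (Or.inr (Or.inr (Or.inr (Or.inr (Or.inr (Or.inr (Or.inr (Or.inr (Or.inr (Or.inl ⟨rfl, rfl⟩)))))))))))))))))))))))) hP hle
      simp only [Nat.cast_ofNat, Int.cast_ofNat] at h
      subst h
      exact mem_zpowers_of_mk0_eq a (cls_P311_219_fortytwo hθ) ha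
    · exact absurd hprime (by norm_num)
    · exact hprinc P hP0 _ (eq_span_of_inert_fortytwo hθ h3 (by norm_num) hP)
    · exact absurd hprime (by norm_num)
    · exact absurd hprime (by norm_num)
    · exact absurd hprime (by norm_num)
    · -- `p = 317`
      have h := eq_span_pair_of_unique_root_fortytwo hθ h3 (Or.inr (Or.inr (Or.inr (Or.inr (Or.inr (Or.inr (Or.inr (Or.inr (Or.inr (Or.inr (Or.inr (Or.inr (Or.inr (Or.inr (Or.inr (Or.inr (Or.inr (Or.inr (Or.inr (Or.inr (Or.inr (Or.inr (Or.inr (Or.inr (Or.inl ⟨rfl, rfl⟩))))))))))))))))))))))))) hP hle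
      simp only [Nat.cast_ofNat, Int.cast_ofNat] at h
      subst h
      exact mem_zpowers_of_mk0_eq a (cls_P317_223_fortytwo hθ) ha
    · exact absurd hprime (by norm_num)
    · exact absurd hprime (by norm_num)
    · exact absurd hprime (by norm_num)
    · exact absurd hprime (by norm_num)
    · exact absurd hprime (by norm_num)
    · exact absurd hprime (by norm_num)
    · exact absurd hprime (by norm_num)
    · exact absurd hprime (by norm_num)
    · exact absurd hprime (by norm_num)
    · exact absurd hprime (by norm_num)
    · exact absurd hprime (by norm_num)
    · exact absurd hprime (by norm_num)
    · exact absurd hprime (by norm_num)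
    · exact hprinc P hP0 _ (eq_span_of_inert_fortytwo hθ h3 (by norm_num) hP)
    · exact absurd hprime (by norm_num)
    · exact absurd hprime (by norm_num)
    · exact absurd hprime (by norm_num)
    · exact absurd hprime (by norm_num)
    · exact absurd hprime (by norm_num)
    · -- `p = 337`
      have h := eq_span_pair_of_unique_root_fortytwo hθ h3 (Or.inr (Or.inr (Or.inr (Or.inr (Or.inr (Or.inr (Or.inr (Or.inr (Or.inr (Or.inr (Or.inr (Or.inr (Or.inr (Or.inr (Or.inr (Or.inr (Or.inr (Or.inr (Or.inr (Or.inr (Or.inr (Or.inr (Or.inr (Or.inr (Or.inr (⟨rfl, rfl⟩)))))))))))))))))))))))))) hP hle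
      simp only [Nat.cast_ofNat, Int.cast_ofNat] at h
      subst h
      exact mem_zpowers_of_mk0_eq a (cls_P337_316_fortytwo hθ) ha
    · exact absurd hprime (by norm_num)
    · exact absurd hprime (by norm_num)
    · exact absurd hprime (by norm_num)
    · exact absurd hprime (by norm_num)
    · exact absurd hprime (by norm_num)
    · exact absurd hprime (by norm_num)
    · exact absurd hprime (by norm_num)
    · exact absurd hprime (by norm_num)
  have hC : C ∈ H := by rw [htop]; exact Subgroup.mem_top C
  obtain ⟨k, rfl⟩ := Subgroup.mem_zpowers_iff.mp hC
  obtain ⟨q, r, hr, rfl⟩ : ∃ q r : ℤ, (r = 0 ∨ r = 1 ∨ r = 2 ∨ r = 3 ∨ r = 4 ∨ r = 5 ∨ r = 6 ∨ r = 7 ∨ r = 8 ∨ r = 9) ∧ k = 10 * q + r :=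
    ⟨k / 10, k % 10, by omega, by omega⟩
  rw [zpow_add, zpow_mul, ham, one_zpow, one_mul]
  rcases hr with rfl | rfl | rfl | rfl | rfl | rfl | rfl | rfl | rfl | rfl
  · exact Or.inl (zpow_zero a)
  · right; left
    rw [show (1 : ℤ) = 1 + 10 * (0) by norm_num, zpow_add, zpow_mul, ham, one_zpow, mul_one,
      zpow_one, ← ha]
  · right; right; left
    rw [show (2 : ℤ) = 2 + 10 * (0) by norm_num, zpow_add, zpow_mul, ham, one_zpow, mul_one,
      ← ha, ← cls_P17_16_fortytwo hθ]
  · right; right; right; left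
    rw [show (3 : ℤ) = 3 + 10 * (0) by norm_num, zpow_add, zpow_mul, ham, one_zpow, mul_one,
      ← ha, ← cls_P43_19_fortytwo hθ]
  · right; right; right; right; left
    rw [show (4 : ℤ) = -6 + 10 * (1) by norm_num, zpow_add, zpow_mul, ham, one_zpow, mul_one,
      ← ha, ← cls_P17_13_fortytwo hθ]
  · right; right; right; right; right; left
    rw [show (5 : ℤ) = 5 + 10 * (0) by norm_num, zpow_add, zpow_mul, ham, one_zpow, mul_one,
      ← ha, ← cls_P23_20_fortytwo hθ]
  · right; right; right; right; right; right; left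
    rw [show (6 : ℤ) = 6 + 10 * (0) by norm_num, zpow_add, zpow_mul, ham, one_zpow, mul_one,
      ← ha, ← cls_P53_49_fortytwo hθ]
  · right; right; right; right; right; right; right; left
    rw [show (7 : ℤ) = -3 + 10 * (1) by norm_num, zpow_add, zpow_mul, ham, one_zpow, mul_one,
      ← ha, ← cls_P101_74_fortytwo hθ]
  · right; right; right; right; right; right; right; right; left
    rw [show (8 : ℤ) = -2 + 10 * (1) by norm_num, zpow_add, zpow_mul, ham, one_zpow, mul_one,
      ← ha, ← cls_P5_4_fortytwo hθ]
  · right; right; right; right; right; right; right; right; right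
    rw [show (9 : ℤ) = -1 + 10 * (1) by norm_num, zpow_add, zpow_mul, ham, one_zpow, mul_one,
      ← ha, ← cls_P31_21_fortytwo hθ]


end Field


/-! ### The ideal classes of `ℤ[X]/(f₄₂)` and Gompf's conjecture for the traces `42` and `-37` -/

section Matrices

set_option maxHeartbeats 1000000 in
/-- **The ideal classes of `ℤ[Θ₄₂] = ℤ[X]/(f₄₂)`**: every non-zero ideal is in the class of one of
`⟨Θ - 1, 1⟩`, `⟨Θ - 5, 7⟩`, `⟨Θ - 16, 17⟩`, `⟨Θ - 19, 43⟩`, `⟨Θ - 13, 17⟩`, `⟨Θ - 20, 23⟩`, `⟨Θ - 49, 53⟩`, `⟨Θ - 74, 101⟩`, `⟨Θ - 4, 5⟩`, `⟨Θ - 21, 31⟩` (these representatives cover `C(ℤ[Θ₄₂])`). [cite: KimYamada2023, §6.1 (proof of Thm. B)] -/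
theorem ideal_class_adjoinRoot_fortytwo (J : Ideal (AdjoinRoot (csPoly 42))) (hJ : J ≠ ⊥) :
    ∃ x y : AdjoinRoot (csPoly 42), x ≠ 0 ∧ y ≠ 0 ∧
      (span {x} * J = span {y} * csIdeal 1 1 42 ∨ span {x} * J = span {y} * csIdeal 5 7 42 ∨ span {x} * J = span {y} * csIdeal 16 17 42 ∨ span {x} * J = span {y} * csIdeal 19 43 42 ∨ span {x} * J = span {y} * csIdeal 13 17 42 ∨ span {x} * J = span {y} * csIdeal 20 23 42 ∨ span {x} * J = span {y} * csIdeal 49 53 42 ∨ span {x} * J = span {y} * csIdeal 74 101 42 ∨ span {x} * J = span {y} * csIdeal 4 5 42 ∨ span {x} * J = span {y} * csIdeal 21 31 42) := by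
  classical
  set θ' := AdjoinRoot.root (csPolyQ 42) with hθ'
  have hθ : aeval θ' (csPoly 42) = 0 := aeval_root_csPoly 42
  have h3 : finrank ℚ (CSField 42) = 3 := finrank_CSField 42
  obtain ⟨e, he⟩ := exists_ringEquiv_adjoinRoot_of_sq hθ h3 csDisc_fortytwo_sq
  set I : Ideal (𝓞 (CSField 42)) := J.map e with hI
  have hIJ : I.map (e.symm : 𝓞 (CSField 42) →+* AdjoinRoot (csPoly 42)) = J := by
    rw [hI]
    exact Ideal.map_of_equiv e (I := J)
  have hI0 : I ≠ ⊥ := by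
    intro h0
    apply hJ
    rw [← hIJ, h0, Ideal.map_bot]
  have hImem : I ∈ (Ideal (𝓞 (CSField 42)))⁰ := mem_nonZeroDivisors_iff_ne_zero.mpr hI0
  have hsymm : ∀ x, (e.symm : 𝓞 (CSField 42) →+* AdjoinRoot (csPoly 42)) (e x) = x :=
    fun x => e.symm_apply_apply x
  have hP7_5 : (span {(7 : 𝓞 (CSField 42)), thetaInt hθ - 5}).map
      (e.symm : 𝓞 (CSField 42) →+* AdjoinRoot (csPoly 42)) = csIdeal 5 7 42 := by
    rw [Ideal.map_span, Set.image_insert_eq, Set.image_singleton, map_sub, ← he, hsymm, map_ofNat,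
      map_ofNat, csIdeal, Set.pair_comm]
    simp
  have hP17_16 : (span {(17 : 𝓞 (CSField 42)), thetaInt hθ - 16}).map
      (e.symm : 𝓞 (CSField 42) →+* AdjoinRoot (csPoly 42)) = csIdeal 16 17 42 := by
    rw [Ideal.map_span, Set.image_insert_eq, Set.image_singleton, map_sub, ← he, hsymm, map_ofNat,
      map_ofNat, csIdeal, Set.pair_comm]
    simp
  have hP43_19 : (span {(43 : 𝓞 (CSField 42)), thetaInt hθ - 19}).map
      (e.symm : 𝓞 (CSField 42) →+* AdjoinRoot (csPoly 42)) = csIdeal 19 43 42 := by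
    rw [Ideal.map_span, Set.image_insert_eq, Set.image_singleton, map_sub, ← he, hsymm, map_ofNat,
      map_ofNat, csIdeal, Set.pair_comm]
    simp
  have hP17_13 : (span {(17 : 𝓞 (CSField 42)), thetaInt hθ - 13}).map
      (e.symm : 𝓞 (CSField 42) →+* AdjoinRoot (csPoly 42)) = csIdeal 13 17 42 := by
    rw [Ideal.map_span, Set.image_insert_eq, Set.image_singleton, map_sub, ← he, hsymm, map_ofNat,
      map_ofNat, csIdeal, Set.pair_comm]
    simp
  have hP23_20 : (span {(23 : 𝓞 (CSField 42)), thetaInt hθ - 20}).map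
      (e.symm : 𝓞 (CSField 42) →+* AdjoinRoot (csPoly 42)) = csIdeal 20 23 42 := by
    rw [Ideal.map_span, Set.image_insert_eq, Set.image_singleton, map_sub, ← he, hsymm, map_ofNat,
      map_ofNat, csIdeal, Set.pair_comm]
    simp
  have hP53_49 : (span {(53 : 𝓞 (CSField 42)), thetaInt hθ - 49}).map
      (e.symm : 𝓞 (CSField 42) →+* AdjoinRoot (csPoly 42)) = csIdeal 49 53 42 := by
    rw [Ideal.map_span, Set.image_insert_eq, Set.image_singleton, map_sub, ← he, hsymm, map_ofNat,
      map_ofNat, csIdeal, Set.pair_comm]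
    simp
  have hP101_74 : (span {(101 : 𝓞 (CSField 42)), thetaInt hθ - 74}).map
      (e.symm : 𝓞 (CSField 42) →+* AdjoinRoot (csPoly 42)) = csIdeal 74 101 42 := by
    rw [Ideal.map_span, Set.image_insert_eq, Set.image_singleton, map_sub, ← he, hsymm, map_ofNat,
      map_ofNat, csIdeal, Set.pair_comm]
    simp
  have hP5_4 : (span {(5 : 𝓞 (CSField 42)), thetaInt hθ - 4}).map
      (e.symm : 𝓞 (CSField 42) →+* AdjoinRoot (csPoly 42)) = csIdeal 4 5 42 := by
    rw [Ideal.map_span, Set.image_insert_eq, Set.image_singleton, map_sub, ← he, hsymm, map_ofNat,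
      map_ofNat, csIdeal, Set.pair_comm]
    simp
  have hP31_21 : (span {(31 : 𝓞 (CSField 42)), thetaInt hθ - 21}).map
      (e.symm : 𝓞 (CSField 42) →+* AdjoinRoot (csPoly 42)) = csIdeal 21 31 42 := by
    rw [Ideal.map_span, Set.image_insert_eq, Set.image_singleton, map_sub, ← he, hsymm, map_ofNat,
      map_ofNat, csIdeal, Set.pair_comm]
    simp
  have hcase : ∀ (P : Ideal (𝓞 (CSField 42))) (hP0 : P ∈ (Ideal (𝓞 (CSField 42)))⁰)
      (Q : Ideal (AdjoinRoot (csPoly 42))),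
      P.map (e.symm : 𝓞 (CSField 42) →+* AdjoinRoot (csPoly 42)) = Q →
      ClassGroup.mk0 ⟨I, hImem⟩ = ClassGroup.mk0 ⟨P, hP0⟩ →
        ∃ x y : AdjoinRoot (csPoly 42), x ≠ 0 ∧ y ≠ 0 ∧ span {x} * J = span {y} * Q := by
    intro P hP0 Q hPQ hcls
    obtain ⟨x, y, hx, hy, hxy⟩ := ClassGroup.mk0_eq_mk0_iff.mp hcls
    refine ⟨(e.symm : 𝓞 (CSField 42) →+* AdjoinRoot (csPoly 42)) x,
      (e.symm : 𝓞 (CSField 42) →+* AdjoinRoot (csPoly 42)) y,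
      (map_ne_zero_iff _ e.symm.injective).mpr hx, (map_ne_zero_iff _ e.symm.injective).mpr hy, ?_⟩
    have h := congrArg (Ideal.map (e.symm : 𝓞 (CSField 42) →+* AdjoinRoot (csPoly 42))) hxy
    simp only [Ideal.map_mul, Ideal.map_span, Set.image_singleton] at h
    rw [hIJ, hPQ] at h
    exact h
  rcases classGroup_mem_fortytwo hθ h3 (ClassGroup.mk0 ⟨I, hImem⟩) with h1 | hcl | hcl | hcl | hcl | hcl | hcl | hcl | hcl | hcl
  · obtain ⟨z, hz⟩ := ((ClassGroup.mk0_eq_one_iff hImem).mp h1).principal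
    have hz' : I = span {z} := by rw [hz, submodule_span_eq]
    have hz0 : z ≠ 0 := by
      rintro rfl
      apply hI0
      rw [hz', Ideal.span_singleton_eq_bot]
    refine ⟨1, (e.symm : 𝓞 (CSField 42) →+* AdjoinRoot (csPoly 42)) z, one_ne_zero,
      (map_ne_zero_iff _ e.symm.injective).mpr hz0, Or.inl ?_⟩
    rw [Ideal.span_singleton_one, Ideal.top_mul, csIdeal_one_one, Ideal.mul_top, ← hIJ, hz',
      Ideal.map_span, Set.image_singleton]
  · obtain ⟨x, y, hx, hy, h⟩ := hcase _ _ _ hP7_5 hcl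
    exact ⟨x, y, hx, hy, Or.inr (Or.inl h)⟩
  · obtain ⟨x, y, hx, hy, h⟩ := hcase _ _ _ hP17_16 hcl
    exact ⟨x, y, hx, hy, Or.inr (Or.inr (Or.inl h))⟩
  · obtain ⟨x, y, hx, hy, h⟩ := hcase _ _ _ hP43_19 hcl
    exact ⟨x, y, hx, hy, Or.inr (Or.inr (Or.inr (Or.inl h)))⟩
  · obtain ⟨x, y, hx, hy, h⟩ := hcase _ _ _ hP17_13 hcl
    exact ⟨x, y, hx, hy, Or.inr (Or.inr (Or.inr (Or.inr (Or.inl h))))⟩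
  · obtain ⟨x, y, hx, hy, h⟩ := hcase _ _ _ hP23_20 hcl
    exact ⟨x, y, hx, hy, Or.inr (Or.inr (Or.inr (Or.inr (Or.inr (Or.inl h)))))⟩
  · obtain ⟨x, y, hx, hy, h⟩ := hcase _ _ _ hP53_49 hcl
    exact ⟨x, y, hx, hy, Or.inr (Or.inr (Or.inr (Or.inr (Or.inr (Or.inr (Or.inl h))))))⟩
  · obtain ⟨x, y, hx, hy, h⟩ := hcase _ _ _ hP101_74 hcl
    exact ⟨x, y, hx, hy, Or.inr (Or.inr (Or.inr (Or.inr (Or.inr (Or.inr (Or.inr (Or.inl h)))))))⟩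
  · obtain ⟨x, y, hx, hy, h⟩ := hcase _ _ _ hP5_4 hcl
    exact ⟨x, y, hx, hy, Or.inr (Or.inr (Or.inr (Or.inr (Or.inr (Or.inr (Or.inr (Or.inr (Or.inl h))))))))⟩
  · obtain ⟨x, y, hx, hy, h⟩ := hcase _ _ _ hP31_21 hcl
    exact ⟨x, y, hx, hy, Or.inr (Or.inr (Or.inr (Or.inr (Or.inr (Or.inr (Or.inr (Or.inr (Or.inr (h)))))))))⟩

/-- `7 ∣ f₄₂(5)`: `(5, 7, 42) ∈ 𝒞𝒮`. [cite: KimYamada2023, §6.1 (proof of Thm. B)] -/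
theorem rep0_dvd_eval_csPoly_fortytwo : (7 : ℤ) ∣ (csPoly 42).eval 5 := by
  rw [eval_csPoly]; norm_num

/-- `17 ∣ f₄₂(16)`: `(16, 17, 42) ∈ 𝒞𝒮`. [cite: KimYamada2023, §6.1 (proof of Thm. B)] -/
theorem rep1_dvd_eval_csPoly_fortytwo : (17 : ℤ) ∣ (csPoly 42).eval 16 := by
  rw [eval_csPoly]; norm_num

/-- `43 ∣ f₄₂(19)`: `(19, 43, 42) ∈ 𝒞𝒮`. [cite: KimYamada2023, §6.1 (proof of Thm. B)] -/
theorem rep2_dvd_eval_csPoly_fortytwo : (43 : ℤ) ∣ (csPoly 42).eval 19 := by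
  rw [eval_csPoly]; norm_num

/-- `17 ∣ f₄₂(13)`: `(13, 17, 42) ∈ 𝒞𝒮`. [cite: KimYamada2023, §6.1 (proof of Thm. B)] -/
theorem rep3_dvd_eval_csPoly_fortytwo : (17 : ℤ) ∣ (csPoly 42).eval 13 := by
  rw [eval_csPoly]; norm_num

/-- `23 ∣ f₄₂(20)`: `(20, 23, 42) ∈ 𝒞𝒮`. [cite: KimYamada2023, §6.1 (proof of Thm. B)] -/
theorem rep4_dvd_eval_csPoly_fortytwo : (23 : ℤ) ∣ (csPoly 42).eval 20 := by
  rw [eval_csPoly]; norm_num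

/-- `53 ∣ f₄₂(49)`: `(49, 53, 42) ∈ 𝒞𝒮`. [cite: KimYamada2023, §6.1 (proof of Thm. B)] -/
theorem rep5_dvd_eval_csPoly_fortytwo : (53 : ℤ) ∣ (csPoly 42).eval 49 := by
  rw [eval_csPoly]; norm_num

/-- `101 ∣ f₄₂(74)`: `(74, 101, 42) ∈ 𝒞𝒮`. [cite: KimYamada2023, §6.1 (proof of Thm. B)] -/
theorem rep6_dvd_eval_csPoly_fortytwo : (101 : ℤ) ∣ (csPoly 42).eval 74 := by
  rw [eval_csPoly]; norm_num

/-- `5 ∣ f₄₂(4)`: `(4, 5, 42) ∈ 𝒞𝒮`. [cite: KimYamada2023, §6.1 (proof of Thm. B)] -/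
theorem rep7_dvd_eval_csPoly_fortytwo : (5 : ℤ) ∣ (csPoly 42).eval 4 := by
  rw [eval_csPoly]; norm_num

/-- `31 ∣ f₄₂(21)`: `(21, 31, 42) ∈ 𝒞𝒮`. [cite: KimYamada2023, §6.1 (proof of Thm. B)] -/
theorem rep8_dvd_eval_csPoly_fortytwo : (31 : ℤ) ∣ (csPoly 42).eval 21 := by
  rw [eval_csPoly]; norm_num

/-- **Every Cappell–Shaneson matrix of trace `42` is similar to one of 10 standard matrices**
(Prop. 2.14). [cite: KimYamada2023, §6.1 (proof of Thm. B) and Prop. 2.14] -/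
theorem isConj_standardCSMatrix_of_trace_eq_fortytwo (A : SL(3, ℤ))
    (hdet : ((A : Matrix (Fin 3) (Fin 3) ℤ) - 1).det = 1)
    (htr : Matrix.trace (A : Matrix (Fin 3) (Fin 3) ℤ) = 42) :
    IsConj A (standardCSMatrix 1 1 42 (one_dvd _)) ∨
      IsConj A (standardCSMatrix 5 7 42 rep0_dvd_eval_csPoly_fortytwo) ∨
      IsConj A (standardCSMatrix 16 17 42 rep1_dvd_eval_csPoly_fortytwo) ∨
      IsConj A (standardCSMatrix 19 43 42 rep2_dvd_eval_csPoly_fortytwo) ∨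
      IsConj A (standardCSMatrix 13 17 42 rep3_dvd_eval_csPoly_fortytwo) ∨
      IsConj A (standardCSMatrix 20 23 42 rep4_dvd_eval_csPoly_fortytwo) ∨
      IsConj A (standardCSMatrix 49 53 42 rep5_dvd_eval_csPoly_fortytwo) ∨
      IsConj A (standardCSMatrix 74 101 42 rep6_dvd_eval_csPoly_fortytwo) ∨
      IsConj A (standardCSMatrix 4 5 42 rep7_dvd_eval_csPoly_fortytwo) ∨
      IsConj A (standardCSMatrix 21 31 42 rep8_dvd_eval_csPoly_fortytwo) := by
  have hcover : ∀ J : Ideal (AdjoinRoot (csPoly 42)), J ≠ ⊥ →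
      ∃ (c d : ℤ) (_ : d ∣ (csPoly 42).eval c) (x y : AdjoinRoot (csPoly 42)),
        x ≠ 0 ∧ y ≠ 0 ∧ Ideal.span {x} * J = Ideal.span {y} * csIdeal c d 42 ∧
          ((c = 1 ∧ d = 1) ∨ (c = 5 ∧ d = 7) ∨ (c = 16 ∧ d = 17) ∨ (c = 19 ∧ d = 43) ∨ (c = 13 ∧ d = 17) ∨ (c = 20 ∧ d = 23) ∨ (c = 49 ∧ d = 53) ∨ (c = 74 ∧ d = 101) ∨ (c = 4 ∧ d = 5) ∨ (c = 21 ∧ d = 31)) := by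
    intro J hJ
    obtain ⟨x, y, hx, hy, hxy⟩ := ideal_class_adjoinRoot_fortytwo J hJ
    rcases hxy with h0 | h1 | h2 | h3 | h4 | h5 | h6 | h7 | h8 | h9
    · exact ⟨1, 1, one_dvd _, x, y, hx, hy, h0, Or.inl ⟨rfl, rfl⟩⟩
    · exact ⟨5, 7, rep0_dvd_eval_csPoly_fortytwo, x, y, hx, hy, h1, Or.inr (Or.inl ⟨rfl, rfl⟩)⟩
    · exact ⟨16, 17, rep1_dvd_eval_csPoly_fortytwo, x, y, hx, hy, h2, Or.inr (Or.inr (Or.inl ⟨rfl, rfl⟩))⟩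
    · exact ⟨19, 43, rep2_dvd_eval_csPoly_fortytwo, x, y, hx, hy, h3, Or.inr (Or.inr (Or.inr (Or.inl ⟨rfl, rfl⟩)))⟩
    · exact ⟨13, 17, rep3_dvd_eval_csPoly_fortytwo, x, y, hx, hy, h4, Or.inr (Or.inr (Or.inr (Or.inr (Or.inl ⟨rfl, rfl⟩))))⟩
    · exact ⟨20, 23, rep4_dvd_eval_csPoly_fortytwo, x, y, hx, hy, h5, Or.inr (Or.inr (Or.inr (Or.inr (Or.inr (Or.inl ⟨rfl, rfl⟩)))))⟩
    · exact ⟨49, 53, rep5_dvd_eval_csPoly_fortytwo, x, y, hx, hy, h6, Or.inr (Or.inr (Or.inr (Or.inr (Or.inr (Or.inr (Or.inl ⟨rfl, rfl⟩))))))⟩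
    · exact ⟨74, 101, rep6_dvd_eval_csPoly_fortytwo, x, y, hx, hy, h7, Or.inr (Or.inr (Or.inr (Or.inr (Or.inr (Or.inr (Or.inr (Or.inl ⟨rfl, rfl⟩)))))))⟩
    · exact ⟨4, 5, rep7_dvd_eval_csPoly_fortytwo, x, y, hx, hy, h8, Or.inr (Or.inr (Or.inr (Or.inr (Or.inr (Or.inr (Or.inr (Or.inr (Or.inl ⟨rfl, rfl⟩))))))))⟩
    · exact ⟨21, 31, rep8_dvd_eval_csPoly_fortytwo, x, y, hx, hy, h9, Or.inr (Or.inr (Or.inr (Or.inr (Or.inr (Or.inr (Or.inr (Or.inr (Or.inr (⟨rfl, rfl⟩)))))))))⟩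
  obtain ⟨c, d, h, hconj, hcd⟩ := exists_isConj_standardCSMatrix_of_cover _ hcover A hdet htr
  rcases hcd with ⟨rfl, rfl⟩ | ⟨rfl, rfl⟩ | ⟨rfl, rfl⟩ | ⟨rfl, rfl⟩ | ⟨rfl, rfl⟩ | ⟨rfl, rfl⟩ | ⟨rfl, rfl⟩ | ⟨rfl, rfl⟩ | ⟨rfl, rfl⟩ | ⟨rfl, rfl⟩
  · exact Or.inl hconj
  · exact Or.inr (Or.inl hconj)
  · exact Or.inr (Or.inr (Or.inl hconj))
  · exact Or.inr (Or.inr (Or.inr (Or.inl hconj)))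
  · exact Or.inr (Or.inr (Or.inr (Or.inr (Or.inl hconj))))
  · exact Or.inr (Or.inr (Or.inr (Or.inr (Or.inr (Or.inl hconj)))))
  · exact Or.inr (Or.inr (Or.inr (Or.inr (Or.inr (Or.inr (Or.inl hconj))))))
  · exact Or.inr (Or.inr (Or.inr (Or.inr (Or.inr (Or.inr (Or.inr (Or.inl hconj)))))))
  · exact Or.inr (Or.inr (Or.inr (Or.inr (Or.inr (Or.inr (Or.inr (Or.inr (Or.inl hconj))))))))
  · exact Or.inr (Or.inr (Or.inr (Or.inr (Or.inr (Or.inr (Or.inr (Or.inr (Or.inr (hconj)))))))))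

/-- **Kim–Yamada 2023, Theorem B for the trace `42`, PROVED (inductive step of Lemma 6.1: granted the conjecture for the smaller traces named as hypotheses)**: the non-trivial classes move by
Gompf moves to the traces `0` (from `(5, 7, 42)`), `8` (from `(16, 17, 42)`), `-1` (from `(19, 43, 42)`), `8` (from `(13, 17, 42)`), `-4` (from `(20, 23, 42)`), `-11` (from `(49, 53, 42)`), `-59` (from `(74, 101, 42)`), `2` (from `(4, 5, 42)`), `11` (from `(21, 31, 42)`), where Gompf's conjecture holds or is assumed. [cite: KimYamada2023, Thm. B, Lemma 6.1 and §6.1] -/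
theorem gompfConjectureForTrace_fortytwo_of
    (hneg59 : GompfConjectureForTrace (-59))
    (hneg11 : GompfConjectureForTrace (-11)) : GompfConjectureForTrace 42 := by
  intro A hdet htr
  rcases isConj_standardCSMatrix_of_trace_eq_fortytwo A hdet htr with h0 | h1 | h2 | h3 | h4 | h5 | h6 | h7 | h8 | h9
  · exact (GompfEquiv.of_isConj h0).trans (gompfEquiv_standardCSMatrix_one_one 40 (one_dvd _))
  · exact (GompfEquiv.of_isConj h1).trans
      (gompfEquiv_standardCSMatrix_akbulutKirbyMatrix_of_modEq
        (gompfConjectureForTrace_of_mem_Icc_neg_seven_twelve (by norm_num)) rep0_dvd_eval_csPoly_fortytwo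
        (show (42 : ℤ) ≡ 0 [ZMOD 7] by decide))
  · exact (GompfEquiv.of_isConj h2).trans
      (gompfEquiv_standardCSMatrix_akbulutKirbyMatrix_of_modEq
        (gompfConjectureForTrace_of_mem_Icc_neg_seven_twelve (by norm_num)) rep1_dvd_eval_csPoly_fortytwo
        (show (42 : ℤ) ≡ 8 [ZMOD 17] by decide))
  · exact (GompfEquiv.of_isConj h3).trans
      (gompfEquiv_standardCSMatrix_akbulutKirbyMatrix_of_modEq
        (gompfConjectureForTrace_of_mem_Icc_neg_seven_twelve (by norm_num)) rep2_dvd_eval_csPoly_fortytwo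
        (show (42 : ℤ) ≡ -1 [ZMOD 43] by decide))
  · exact (GompfEquiv.of_isConj h4).trans
      (gompfEquiv_standardCSMatrix_akbulutKirbyMatrix_of_modEq
        (gompfConjectureForTrace_of_mem_Icc_neg_seven_twelve (by norm_num)) rep3_dvd_eval_csPoly_fortytwo
        (show (42 : ℤ) ≡ 8 [ZMOD 17] by decide))
  · exact (GompfEquiv.of_isConj h5).trans
      (gompfEquiv_standardCSMatrix_akbulutKirbyMatrix_of_modEq
        (gompfConjectureForTrace_of_mem_Icc_neg_seven_twelve (by norm_num)) rep4_dvd_eval_csPoly_fortytwo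
        (show (42 : ℤ) ≡ -4 [ZMOD 23] by decide))
  · exact (GompfEquiv.of_isConj h6).trans
      (gompfEquiv_standardCSMatrix_akbulutKirbyMatrix_of_modEq
        hneg11 rep5_dvd_eval_csPoly_fortytwo
        (show (42 : ℤ) ≡ -11 [ZMOD 53] by decide))
  · exact (GompfEquiv.of_isConj h7).trans
      (gompfEquiv_standardCSMatrix_akbulutKirbyMatrix_of_modEq
        hneg59 rep6_dvd_eval_csPoly_fortytwo
        (show (42 : ℤ) ≡ -59 [ZMOD 101] by decide))
  · exact (GompfEquiv.of_isConj h8).trans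
      (gompfEquiv_standardCSMatrix_akbulutKirbyMatrix_of_modEq
        (gompfConjectureForTrace_of_mem_Icc_neg_seven_twelve (by norm_num)) rep7_dvd_eval_csPoly_fortytwo
        (show (42 : ℤ) ≡ 2 [ZMOD 5] by decide))
  · exact (GompfEquiv.of_isConj h9).trans
      (gompfEquiv_standardCSMatrix_akbulutKirbyMatrix_of_modEq
        (gompfConjectureForTrace_of_mem_Icc_neg_seven_twelve (by norm_num)) rep8_dvd_eval_csPoly_fortytwo
        (show (42 : ℤ) ≡ 11 [ZMOD 31] by decide))

/-- **Theorem B for the trace `-37`** (`= 5 - 42`), by Theorem A (under the same hypotheses). [cite: KimYamada2023, Thm. A and Thm. B] -/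
theorem gompfConjectureForTrace_neg_thirtyseven_of
    (hneg59 : GompfConjectureForTrace (-59))
    (hneg11 : GompfConjectureForTrace (-11)) : GompfConjectureForTrace (-37) := by
  have h := gompfConjectureForTrace_of_five_sub (gompfConjectureForTrace_fortytwo_of hneg59 hneg11)
  norm_num at h
  exact h

end Matrices


end Literature.Topology.FourManifolds

end
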